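import Literature.NumberTheory.ComplexMultiplication.CasselmanTwistCharacterContinuous
import Literature.NumberTheory.ComplexMultiplication.ArtinLiftAlgebra
import HarnessLib

/-!
# The twist `c_σ = β(y)f(y)⁻¹` fixes any finite level of `K/𝔞` for `σ` fixing a finite set of
# algebraic numbers (Shimura 1998 §21.4 proof of Thm. 21.4 pp. 147–148 with §18.3, §18.9; finite-level form of the
# continuity of the twist character)

Topic `Literature/NumberTheory/ComplexMultiplication`; namespace
`Literature.NumberTheory.ComplexMultiplication`.  PROOF-ONLY file (no definition, no named fact; net
Literature debt 0).  Cell `hodgecm-mathlib`, sub-line `a2b-twisted-galois-model` of the `h21` line, FL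
adapter (A3) in the σ-FORM requested by the assembler of `stub_finiteLevelReciprocity`: the continuity
of the twist character `t̄ : Gal(k^ab/k) → K̂_f^×` (`CasselmanTwistCharacterContinuous`) read back on
automorphisms `σ ∈ Aut(ℂ/k)` and their idèle lifts (`IsArtinLift k y σ` = «`σ = [y, k]` on `k_ab`»).

WHAT IS PROVED (hypotheses as in `CasselmanTwistCharacterContinuous`: `χ` a Hecke character of
`k ⊂ ℂ`, `τ₀ : K → ℂ`, `f : k_𝐀^× →* K̂_f^×` a CONTINUOUS homomorphism, (19.10b) `hb`, and the
Γ^ab-form `hindep` of «`c` is uniquely determined by `σ`»; `𝔞` a fractional ideal of `𝓞_K`):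

* `exists_intermediateField_forall_twist_mem_stabilizer` — Γ_k-FORM: for finitely many points
  `W ⊆ K/𝔞` there is a FINITE extension `E ⊆ k̄` of `k` such that every `γ ∈ Gal(k̄/E)` and every
  idèle `y` with `γ|_{k^ab} = [y, k]` have `c(y) = b·f(y)⁻¹` in the stabiliser of `(𝔞; W)` (Krull
  topology: the open subgroup `{σ̄ | c_σ̄ stabilises (𝔞; W)}` of `Gal(k^ab/k)`,
  `isOpen_setOf_twistHom_mem_stabilizer`, pulled back to `Gal(k̄/k)` contains some `Gal(k̄/E)`).
* `exists_finset_forall_isArtinLift_twist_mem_stabilizer` — σ-FORM: there is a finite set `F ⊂ ℂ` of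
  ALGEBRAIC numbers such that for every `σ ∈ Aut(ℂ/k)` fixing `F` pointwise, every idèle `y` with
  `σ = [y, k]` on `k_ab` and every `b` with `χ(y_fin) = τ₀ b`: `b·f(y)⁻¹` stabilises `(𝔞; W)` (take
  `F = e(basis of E)` for an embedding `e : k̄ → ℂ`; a `σ` fixing `F` fixes `e(E)`; the witness
  `γ ∈ Gal(k̄/k)` of `σ = [y, k]` along `e` — `IsArtinLift.exists_of_embedding` — then fixes `E`).
* `exists_finset_forall_isArtinLift_ideleMulEquiv_mk_eq` — LEVEL-`N` FORM ((18.3a) on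
  representatives): for `N ≥ 1` such an `F` with `c · (u mod 𝔞) = u (mod c𝔞)` for ALL `u ∈ N⁻¹𝔞`
  (finitely many `𝓞_K`-generators of `N⁻¹𝔞` as the points `W`; `𝓞_K`-linearity of `u ↦ c·u`).

## References

* [Shimura1998] G. Shimura, *Abelian Varieties with Complex Multiplication and Modular Functions*
  (1998), §21.4 proof of Thm. 21.4 (pp. 147–148), §18.3 (18.3a) (p. 122), §18.9 (18.9a) (p. 130).
* [CasselsFrohlichANT1967] J. Tate, Ch. VII of Cassels–Fröhlich (1967), §5.1 (D), §5.4.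
* [NeukirchANT1999] J. Neukirch, *Algebraic Number Theory* (1999), Ch. IV §1, Ch. VI §1 (1.8).
-/

set_option autoImplicit false

noncomputable section

open NumberField Field Topology IsDedekindDomain
open scoped nonZeroDivisors

namespace Literature.NumberTheory.ComplexMultiplication

open Literature.NumberTheory.GaloisRepresentations
open Literature.NumberTheory.GaloisRepresentations.HeckeCharacter (infPart)
open Literature.NumberTheory.NumberFields
open Field (absoluteGaloisGroup)
open Field.absoluteGaloisGroup (toAlgEquiv)

section FiniteLevel

variable {k : Type} [Field k] [NumberField k] [Algebra k ℂ] {K : Type} [Field K] [NumberField K]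
  (χ : HeckeCharacter k) (τ₀ : K →+* ℂ) (f : ideleGroup k →* (FiniteAdeleRing (𝓞 K) K)ˣ)

omit [Algebra k ℂ] in
/-- **Γ_k-form.**  For finitely many points `W ⊆ K/𝔞` there is a finite extension `E ⊆ k̄` of `k`
such that for every `γ ∈ Gal(k̄/k)` fixing `E` and every idèle `y` with `γ|_{k^ab} = [y, k]`: the twist
`c(y) = b·f(y)⁻¹` (`χ(y_fin) = τ₀ b`) lies in the stabiliser of `(𝔞; W)` — the pull-back to `Gal(k̄/k)`
of the open set `{σ̄ | t̄(σ̄) stabilises (𝔞; W)}` (`isOpen_setOf_twistHom_mem_stabilizer`) is a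
neighbourhood of `1` in the Krull topology, hence contains some `Gal(k̄/E)`, `[E : k] < ∞`.
[cite: Shimura1998, §21.4, proof of Thm. 21.4 (pp. 147–148); §18.9 (18.9a) p. 130] [cite: CasselsFrohlichANT1967, Ch. VII §5.4 (PDF p. 213)] -/
theorem exists_intermediateField_forall_twist_mem_stabilizer (hf : Continuous f)
    (hb : ∀ x : ideleGroup k, (x : AdeleRing (𝓞 k) k).1 = 1 → ∃ b : K, ((χ x : ℂˣ) : ℂ) = τ₀ b)
    (hindep : ∀ y y' : ideleGroup k, ideleArtinMap k y = ideleArtinMap k y' → ∀ b b' : Kˣ,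
      ((χ ((infiniteIdeles k (infPart k y))⁻¹ * y) : ℂˣ) : ℂ) = τ₀ (b : K) →
      ((χ ((infiniteIdeles k (infPart k y'))⁻¹ * y') : ℂˣ) : ℂ) = τ₀ (b' : K) →
        FiniteAdeleRing.unitEmbedding (𝓞 K) K b * (f y)⁻¹ =
          FiniteAdeleRing.unitEmbedding (𝓞 K) K b' * (f y')⁻¹)
    (𝔞 : FractionalIdeal (𝓞 K)⁰ K) (h𝔞 : 𝔞 ≠ 0) {W : Set (K ⧸ (𝔞 : Submodule (𝓞 K) K))}
    (hW : W.Finite) :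
    ∃ E : IntermediateField k (AlgebraicClosure k), FiniteDimensional k E ∧
      ∀ γ : absoluteGaloisGroup k, toAlgEquiv k γ ∈ E.fixingSubgroup →
        ∀ y : ideleGroup k, absGaloisAbProj k γ = ideleArtinMap k y → ∀ b : Kˣ,
          ((χ ((infiniteIdeles k (infPart k y))⁻¹ * y) : ℂˣ) : ℂ) = τ₀ (b : K) →
            FiniteAdeleRing.unitEmbedding (𝓞 K) K b * (f y)⁻¹ ∈ IdeleAction.stabilizer 𝔞 h𝔞 W := by
  obtain ⟨t, ht⟩ := exists_twistHom_ideleArtinMap χ τ₀ f hb hindep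
  have hopen := isOpen_setOf_twistHom_mem_stabilizer χ τ₀ f hf t ht 𝔞 h𝔞 hW
  -- the pull-back to `Γ_k` is a neighbourhood of `1`
  have hc : Continuous (absGaloisAbProj k) := QuotientGroup.continuous_mk
  have h1 : (absGaloisAbProj k) ⁻¹'
      {σ : absoluteGaloisGroupAbelianization k | t σ ∈ IdeleAction.stabilizer 𝔞 h𝔞 W} ∈
        𝓝 (1 : absoluteGaloisGroup k) := by
    refine (hopen.preimage hc).mem_nhds ?_
    rw [Set.mem_preimage, Set.mem_setOf_eq, map_one, map_one]
    exact one_mem _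
  obtain ⟨E, hEfd, hE⟩ := (krullTopology_mem_nhds_one_iff k (AlgebraicClosure k) _).mp h1
  refine ⟨E, hEfd, fun γ hγ y hγy b hby => ?_⟩
  have hmem : γ ∈ (absGaloisAbProj k) ⁻¹'
      {σ : absoluteGaloisGroupAbelianization k | t σ ∈ IdeleAction.stabilizer 𝔞 h𝔞 W} := hE hγ
  rw [Set.mem_preimage, Set.mem_setOf_eq, hγy, ht y b hby] at hmem
  exact hmem

omit [NumberField k] in
/-- An automorphism of `ℂ` over `k` fixing the images `e(b_i)` of a `k`-basis of a subfield `E ⊆ k̄`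
under an embedding `e : k̄ → ℂ` fixes `e(E)` pointwise (`k`-linearity). [folklore] -/
private theorem apply_embedding_eq_of_forall_basis {E : IntermediateField k (AlgebraicClosure k)}
    {ι : Type*} [Fintype ι] (bE : Module.Basis ι k E) (e : AlgebraicClosure k →ₐ[k] ℂ)
    (σ : ℂ ≃ₐ[k] ℂ) (hσ : ∀ i, σ (e ((bE i : E) : AlgebraicClosure k)) = e ((bE i : E) : AlgebraicClosure k))
    {x : AlgebraicClosure k} (hx : x ∈ E) : σ (e x) = e x := by
  have hx' : x = ∑ i, bE.repr ⟨x, hx⟩ i • ((bE i : E) : AlgebraicClosure k) := by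
    conv_lhs => rw [show x = ((⟨x, hx⟩ : E) : AlgebraicClosure k) from rfl, ← bE.sum_repr ⟨x, hx⟩]
    simp only [IntermediateField.coe_sum, IntermediateField.coe_smul]
  rw [hx']
  simp only [map_sum, Algebra.smul_def, map_mul, AlgHom.commutes, AlgEquiv.commutes, hσ]

/-- The image of an element of `k̄` under a `k`-embedding `k̄ → ℂ` is an algebraic number (`k̄/k` and
`k/ℚ` are algebraic). [folklore] -/
private theorem isAlgebraic_rat_embedding (e : AlgebraicClosure k →ₐ[k] ℂ) (x : AlgebraicClosure k) :
    IsAlgebraic ℚ (e x) := by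
  haveI : IsScalarTower ℚ k (AlgebraicClosure k) := IsScalarTower.of_algebraMap_eq fun q => by
    rw [eq_ratCast, eq_ratCast, map_ratCast]
  haveI : Algebra.IsAlgebraic ℚ (AlgebraicClosure k) := Algebra.IsAlgebraic.trans ℚ k (AlgebraicClosure k)
  exact (Algebra.IsAlgebraic.isAlgebraic x).algHom e.toRingHom.toRatAlgHom

/-- **σ-form.**  For finitely many points `W ⊆ K/𝔞` there is a finite set `F ⊂ ℂ` of ALGEBRAIC numbers
such that: for every `σ ∈ Aut(ℂ/k)` fixing `F` pointwise, every idèle `y` with `σ = [y, k]` on `k_ab`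
(`IsArtinLift k y σ`) and every `b ∈ K^×` with `χ(y_fin) = τ₀ b`, the twist `b·f(y)⁻¹` stabilises
`(𝔞; W)`.  (`F = e(basis of E)` for the `E` of `exists_intermediateField_forall_twist_mem_stabilizer`
and an embedding `e : k̄ → ℂ`; the restriction `γ ∈ Gal(k̄/k)` of `σ` along `e`
(`IsArtinLift.exists_of_embedding`) fixes `E` because `σ` fixes `e(E)`.)
[cite: Shimura1998, §21.4, proof of Thm. 21.4 (pp. 147–148); §18.3 p. 122 («[a, M]»); §18.9 (18.9a) p. 130] [cite: NeukirchANT1999, Ch. IV §1] -/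
theorem exists_finset_forall_isArtinLift_twist_mem_stabilizer (hf : Continuous f)
    (hb : ∀ x : ideleGroup k, (x : AdeleRing (𝓞 k) k).1 = 1 → ∃ b : K, ((χ x : ℂˣ) : ℂ) = τ₀ b)
    (hindep : ∀ y y' : ideleGroup k, ideleArtinMap k y = ideleArtinMap k y' → ∀ b b' : Kˣ,
      ((χ ((infiniteIdeles k (infPart k y))⁻¹ * y) : ℂˣ) : ℂ) = τ₀ (b : K) →
      ((χ ((infiniteIdeles k (infPart k y'))⁻¹ * y') : ℂˣ) : ℂ) = τ₀ (b' : K) →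
        FiniteAdeleRing.unitEmbedding (𝓞 K) K b * (f y)⁻¹ =
          FiniteAdeleRing.unitEmbedding (𝓞 K) K b' * (f y')⁻¹)
    (𝔞 : FractionalIdeal (𝓞 K)⁰ K) (h𝔞 : 𝔞 ≠ 0) {W : Set (K ⧸ (𝔞 : Submodule (𝓞 K) K))}
    (hW : W.Finite) :
    ∃ F : Finset ℂ, (∀ z ∈ F, IsAlgebraic ℚ z) ∧
      ∀ σ : ℂ ≃ₐ[k] ℂ, (∀ z ∈ F, σ z = z) → ∀ y : ideleGroup k, IsArtinLift k y σ → ∀ b : Kˣ,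
        ((χ ((infiniteIdeles k (infPart k y))⁻¹ * y) : ℂˣ) : ℂ) = τ₀ (b : K) →
          FiniteAdeleRing.unitEmbedding (𝓞 K) K b * (f y)⁻¹ ∈ IdeleAction.stabilizer 𝔞 h𝔞 W := by
  classical
  obtain ⟨E, hEfd, hE⟩ :=
    exists_intermediateField_forall_twist_mem_stabilizer χ τ₀ f hf hb hindep 𝔞 h𝔞 hW
  haveI := hEfd
  let e : AlgebraicClosure k →ₐ[k] ℂ := IsAlgClosed.lift
  let bE := Module.finBasis k E
  refine ⟨Finset.univ.image fun i => e ((bE i : E) : AlgebraicClosure k), ?_, ?_⟩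
  · intro z hz
    obtain ⟨i, -, rfl⟩ := Finset.mem_image.1 hz
    exact isAlgebraic_rat_embedding e _
  · intro σ hσ y hy b hby
    obtain ⟨γ, hγσ, hγy⟩ := hy.exists_of_embedding e
    refine hE γ ?_ y hγy b hby
    rw [IntermediateField.mem_fixingSubgroup_iff]
    intro x hx
    apply e.toRingHom.injective
    change e (toAlgEquiv k γ x) = e x
    rw [hγσ x]
    exact apply_embedding_eq_of_forall_basis bE e σ
      (fun i => hσ _ (Finset.mem_image_of_mem _ (Finset.mem_univ i))) hx

/-- **Level-`N` form** (the hypothesis `hc` of the finite-level engine, read at the automorphisms of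
`ℂ`): for `N ≥ 1` there is a finite set `F ⊂ ℂ` of algebraic numbers such that for every
`σ ∈ Aut(ℂ/k)` fixing `F`, every idèle lift `y` of `σ` and every `b` with `χ(y_fin) = τ₀ b`, the twist
`c = b·f(y)⁻¹` satisfies `c𝔞 = 𝔞` and `c · (u mod 𝔞) = u (mod c𝔞)` ((18.3a)) for EVERY `u ∈ N⁻¹𝔞`
(the σ-form for the classes of finitely many `𝓞_K`-generators of `N⁻¹𝔞`, then `𝓞_K`-linearity of
`u ↦ c · (u mod 𝔞)`). [cite: Shimura1998, §21.4, proof of Thm. 21.4 (pp. 147–148); §18.3 (18.3a) p. 122; §18.9 (18.9a) p. 130] -/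
theorem exists_finset_forall_isArtinLift_ideleMulEquiv_mk_eq (hf : Continuous f)
    (hb : ∀ x : ideleGroup k, (x : AdeleRing (𝓞 k) k).1 = 1 → ∃ b : K, ((χ x : ℂˣ) : ℂ) = τ₀ b)
    (hindep : ∀ y y' : ideleGroup k, ideleArtinMap k y = ideleArtinMap k y' → ∀ b b' : Kˣ,
      ((χ ((infiniteIdeles k (infPart k y))⁻¹ * y) : ℂˣ) : ℂ) = τ₀ (b : K) →
      ((χ ((infiniteIdeles k (infPart k y'))⁻¹ * y') : ℂˣ) : ℂ) = τ₀ (b' : K) →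
        FiniteAdeleRing.unitEmbedding (𝓞 K) K b * (f y)⁻¹ =
          FiniteAdeleRing.unitEmbedding (𝓞 K) K b' * (f y')⁻¹)
    (𝔞 : FractionalIdeal (𝓞 K)⁰ K) (h𝔞 : 𝔞 ≠ 0) {N : ℕ} (hN : 0 < N) :
    ∃ F : Finset ℂ, (∀ z ∈ F, IsAlgebraic ℚ z) ∧
      ∀ σ : ℂ ≃ₐ[k] ℂ, (∀ z ∈ F, σ z = z) → ∀ y : ideleGroup k, IsArtinLift k y σ → ∀ b : Kˣ,
        ((χ ((infiniteIdeles k (infPart k y))⁻¹ * y) : ℂˣ) : ℂ) = τ₀ (b : K) →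
          IdeleAction.ideleMulIdeal (FiniteAdeleRing.unitEmbedding (𝓞 K) K b * (f y)⁻¹) 𝔞 = 𝔞 ∧
          ∀ u : K, (N : K) * u ∈ 𝔞 →
            IdeleAction.ideleMulEquiv (FiniteAdeleRing.unitEmbedding (𝓞 K) K b * (f y)⁻¹) 𝔞 h𝔞
              (Submodule.Quotient.mk u) = Submodule.Quotient.mk u := by
  classical
  have hN0 : (N : K) ≠ 0 := Nat.cast_ne_zero.2 hN.ne'
  -- `N⁻¹𝔞` and finitely many `𝓞_K`-generators of it
  let M : FractionalIdeal (𝓞 K)⁰ K := FractionalIdeal.spanSingleton (𝓞 K)⁰ ((N : K)⁻¹) * 𝔞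
  have hMfg : (M : Submodule (𝓞 K) K).FG :=
    (FractionalIdeal.isNoetherian_iff.mp (FractionalIdeal.isNoetherian M)) M le_rfl
  obtain ⟨G, hG⟩ := hMfg
  have hmemM : ∀ u : K, (N : K) * u ∈ 𝔞 → u ∈ (M : Submodule (𝓞 K) K) := fun u hu => by
    rw [FractionalIdeal.mem_coe, FractionalIdeal.mem_singleton_mul]
    exact ⟨(N : K) * u, hu, by rw [← mul_assoc, inv_mul_cancel₀ hN0, one_mul]⟩
  -- the σ-form for the classes of the generators
  obtain ⟨F, hFalg, hF⟩ := exists_finset_forall_isArtinLift_twist_mem_stabilizer χ τ₀ f hf hb hindep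
    𝔞 h𝔞 (W := (fun g : K => Submodule.Quotient.mk g) '' (G : Set K)) (G.finite_toSet.image _)
  refine ⟨F, hFalg, fun σ hσ y hy b hby => ?_⟩
  obtain ⟨h𝔞eq, hWfix⟩ := (IdeleAction.mem_stabilizer_iff h𝔞 _ _).1 (hF σ hσ y hy b hby)
  refine ⟨h𝔞eq, fun u hu => ?_⟩
  -- `u ↦ c · (u mod 𝔞)` and `u ↦ u mod c𝔞` are `𝓞_K`-linear and agree on the generators
  set t := FiniteAdeleRing.unitEmbedding (𝓞 K) K b * (f y)⁻¹ with ht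
  let L₁ : K →ₗ[𝓞 K] K ⧸ ((IdeleAction.ideleMulIdeal t 𝔞 : FractionalIdeal (𝓞 K)⁰ K) :
      Submodule (𝓞 K) K) :=
    (IdeleAction.ideleMulEquiv t 𝔞 h𝔞).toLinearMap ∘ₗ Submodule.mkQ _
  let L₂ : K →ₗ[𝓞 K] K ⧸ ((IdeleAction.ideleMulIdeal t 𝔞 : FractionalIdeal (𝓞 K)⁰ K) :
      Submodule (𝓞 K) K) := Submodule.mkQ _
  have hagree : ∀ g ∈ (G : Set K), L₁ g = L₂ g := fun g hg => hWfix g ⟨g, hg, rfl⟩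
  have hle : (M : Submodule (𝓞 K) K) ≤ LinearMap.eqLocus L₁ L₂ := by
    rw [← hG]
    exact Submodule.span_le.2 hagree
  exact hle (hmemM u hu)

end FiniteLevel

end Literature.NumberTheory.ComplexMultiplication

end
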